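import Summits.ABC.ABC.Theses.TwistAmplification

/-!
# Slice assembly for the crux `TwistAmplification.MazurKaneLaw` (stmt-ABC-2757)

Support file of the line `peyre-level-torsor-v22` (lead prover-line-stmt-ABC-2757-0, 2026-08-16). The crux
`MazurKaneLaw` (for every `1 < s < 2`, `ε > 0`: `#{abc triples, c ≤ N, rad(abc) ≤ c^s} ≤ C N^{s-1+ε}`) is assembled
from three RADICAL-RANGE statements, which is the `s`-range split asked for by all three triagers of the crux and
recommended by the three line planners:

* the slice law on `[5/3, 2)`: `#{c ≤ N, c^{s'-η} < rad(abc) ≤ c^{s'}} ≤ C N^{s'-1+ε}` for `s' ∈ [5/3, 2)` with a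
  window `η = η(ε) > 0` uniform in `s'` (the target of the line's lever);
* the slice law on `(1, 5/3)` (foreign to the lever: twisted Fermat-cubic level lattices, cube-heavy boxes);
* the hit bound `#{c ≤ N, rad(abc) ≤ c} ≤ C N^{ε}` (the `s → 1⁺` content of the crux, necessary by the
  cdisprove gauge `abcHitCount_le_of_mazurKaneLaw`).

`SliceAssembly` (registered glue name) is the kernel-checked glue `High → Low → Hit → MazurKaneLaw`: peel slices of a common
width `η` from `s` down to the floor `x₀ = 1` (`MazurKaneLaw.assemble`, induction on the number of slices), every
partial bound weakened to the target exponent `s - 1 + ε`. The assembly is stated once abstractly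
(`MazurKaneLaw.assemble`: a monotone counting function with a peeling inequality) so that no auxiliary definition
is needed in this proof file; the sets of the crux, of the slices and of the hits are written inline, verbatim as in
the route file and in the registered stubs of the line. Nothing here is specific to the lever: the same glue serves
any line that proves the three ranges separately.
-/

namespace Summit.ABC.ABC.Theorems

open Literature.NumberTheory.DiophantineGeometry

/-! ## Abstract slice assembly -/

/-- **Abstract slice assembly.** Let `m : ℝ → ℝ` be monotone ("cumulative count at exponent `x`") and satisfy the
peeling inequality `m x ≤ m (x - η) + sl x` ("cumulative = lower cumulative + slice"). If `m x₀ ≤ C₀ · P` at the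
floor and `sl x ≤ Cf x · P` for the levels `x ∈ (x₀, x_max]`, then `m x ≤ (C₀ + Σ_{j<k} Cf (x - jη)) · P` for every
`x ≤ x_max` with `x - kη ≤ x₀` (induction on the number `k` of slices). [folklore] -/
theorem MazurKaneLaw.assemble {m sl : ℝ → ℝ} {x₀ xmax η P C₀ : ℝ} (hη : 0 < η) (hP : 0 ≤ P)
    (hmono : ∀ x y : ℝ, x ≤ y → m x ≤ m y) (hpeel : ∀ x : ℝ, m x ≤ m (x - η) + sl x)
    (hfloor : m x₀ ≤ C₀ * P) (Cf : ℝ → ℝ) (hCf : ∀ x, 0 ≤ Cf x)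
    (hslice : ∀ x, x₀ < x → x ≤ xmax → sl x ≤ Cf x * P) :
    ∀ k : ℕ, ∀ x : ℝ, x ≤ xmax → x - k * η ≤ x₀ →
      m x ≤ (C₀ + ∑ j ∈ Finset.range k, Cf (x - j * η)) * P := by
  -- the floor case, valid for every `k`
  have hbase : ∀ k : ℕ, ∀ x : ℝ, x ≤ x₀ →
      m x ≤ (C₀ + ∑ j ∈ Finset.range k, Cf (x - j * η)) * P := by
    intro k x hx
    have hS : 0 ≤ ∑ j ∈ Finset.range k, Cf (x - j * η) := Finset.sum_nonneg fun j _ => hCf _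
    calc m x ≤ C₀ * P := (hmono x x₀ hx).trans hfloor
      _ ≤ (C₀ + ∑ j ∈ Finset.range k, Cf (x - j * η)) * P := by
          rw [add_mul]
          exact le_add_of_nonneg_right (mul_nonneg hS hP)
  intro k
  induction k with
  | zero =>
      intro x _ hx
      exact hbase 0 x (by simpa using hx)
  | succ k ih =>
      intro x hxm hxk
      rcases le_or_gt x x₀ with hx | hx
      · exact hbase (k + 1) x hx
      · have hx' : x - η - (k : ℝ) * η ≤ x₀ := by
          have h := hxk
          push_cast at h
          linarith
        have ih' := ih (x - η) (by linarith) hx'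
        have hsl := hslice x hx hxm
        have hsum : ∑ j ∈ Finset.range (k + 1), Cf (x - j * η) =
            (∑ j ∈ Finset.range k, Cf (x - η - j * η)) + Cf x := by
          rw [Finset.sum_range_succ']
          congr 1
          · refine Finset.sum_congr rfl fun j _ => ?_
            congr 1
            push_cast
            ring
          · simp
        calc m x ≤ m (x - η) + sl x := hpeel x
          _ ≤ (C₀ + ∑ j ∈ Finset.range k, Cf (x - η - j * η)) * P + Cf x * P := add_le_add ih' hsl
          _ = (C₀ + ∑ j ∈ Finset.range (k + 1), Cf (x - j * η)) * P := by rw [hsum]; ring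

/-- The number of slices: `⌈(s - x₀)/η⌉` slices of width `η > 0` reach from `s` down to the floor `x₀`.
[folklore] -/
theorem MazurKaneLaw.exists_steps {s x₀ η : ℝ} (hη : 0 < η) : ∃ J : ℕ, s - J * η ≤ x₀ := by
  refine ⟨⌈(s - x₀) / η⌉₊, ?_⟩
  have h1 : (s - x₀) / η ≤ (⌈(s - x₀) / η⌉₊ : ℝ) := Nat.le_ceil _
  rw [div_le_iff₀ hη] at h1
  linarith

/-! ## The sets of the crux: finiteness, monotonicity, peeling -/

/-- Any set of abc triples with `c ≤ N` is finite (it lies in `[0, N]³`). [folklore] -/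
theorem MazurKaneLaw.finite_of_isABCTriple (N : ℕ) {S : Set (ℕ × ℕ × ℕ)}
    (h : ∀ t ∈ S, IsABCTriple t.1 t.2.1 t.2.2 ∧ t.2.2 ≤ N) : S.Finite := by
  refine ((Set.finite_Iic N).prod ((Set.finite_Iic N).prod (Set.finite_Iic N))).subset ?_
  rintro ⟨a, b, c⟩ ht
  obtain ⟨⟨ha, hb, habc, -⟩, hcN⟩ := h _ ht
  simp only [Set.mem_prod, Set.mem_Iic] at *
  omega

/-- `1 ≤ c` for an abc triple (as a real number). [folklore] -/
theorem MazurKaneLaw.one_le_of_isABCTriple {t : ℕ × ℕ × ℕ} (ht : IsABCTriple t.1 t.2.1 t.2.2) :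
    (1 : ℝ) ≤ (t.2.2 : ℝ) := by
  obtain ⟨ha, _, habc, -⟩ := ht
  have h1 : 1 ≤ t.2.2 := by omega
  exact_mod_cast h1

/-- Monotonicity of the cumulative Mazur–Kane count in the exponent: `{rad ≤ c^x} ⊆ {rad ≤ c^y}` for `x ≤ y`
(as `c ≥ 1`), in counting form. [folklore] -/
theorem MazurKaneLaw.ncard_cumulative_mono (N : ℕ) {x y : ℝ} (h : x ≤ y) :
    (Set.ncard {t : ℕ × ℕ × ℕ | IsABCTriple t.1 t.2.1 t.2.2 ∧ t.2.2 ≤ N ∧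
        ((rad t.1 t.2.1 t.2.2 : ℕ) : ℝ) ≤ (t.2.2 : ℝ) ^ x} : ℝ) ≤
      Set.ncard {t : ℕ × ℕ × ℕ | IsABCTriple t.1 t.2.1 t.2.2 ∧ t.2.2 ≤ N ∧
        ((rad t.1 t.2.1 t.2.2 : ℕ) : ℝ) ≤ (t.2.2 : ℝ) ^ y} := by
  have hfin : {t : ℕ × ℕ × ℕ | IsABCTriple t.1 t.2.1 t.2.2 ∧ t.2.2 ≤ N ∧
      ((rad t.1 t.2.1 t.2.2 : ℕ) : ℝ) ≤ (t.2.2 : ℝ) ^ y}.Finite :=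
    MazurKaneLaw.finite_of_isABCTriple N fun _ ht => ⟨ht.1, ht.2.1⟩
  refine Nat.cast_le.mpr (Set.ncard_le_ncard (fun t ht => ?_) hfin)
  obtain ⟨ht, hN, hle⟩ := ht
  exact ⟨ht, hN, hle.trans (Real.rpow_le_rpow_of_exponent_le (MazurKaneLaw.one_le_of_isABCTriple ht) h)⟩

/-- The peeling step in counting form: `#{rad ≤ c^x} ≤ #{rad ≤ c^{x-η}} + #{c^{x-η} < rad ≤ c^x}`. [folklore] -/
theorem MazurKaneLaw.ncard_cumulative_peel (N : ℕ) (x η : ℝ) :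
    (Set.ncard {t : ℕ × ℕ × ℕ | IsABCTriple t.1 t.2.1 t.2.2 ∧ t.2.2 ≤ N ∧
        ((rad t.1 t.2.1 t.2.2 : ℕ) : ℝ) ≤ (t.2.2 : ℝ) ^ x} : ℝ) ≤
      Set.ncard {t : ℕ × ℕ × ℕ | IsABCTriple t.1 t.2.1 t.2.2 ∧ t.2.2 ≤ N ∧
        ((rad t.1 t.2.1 t.2.2 : ℕ) : ℝ) ≤ (t.2.2 : ℝ) ^ (x - η)} +
      Set.ncard {t : ℕ × ℕ × ℕ | IsABCTriple t.1 t.2.1 t.2.2 ∧ t.2.2 ≤ N ∧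
        (t.2.2 : ℝ) ^ (x - η) < ((rad t.1 t.2.1 t.2.2 : ℕ) : ℝ) ∧
        ((rad t.1 t.2.1 t.2.2 : ℕ) : ℝ) ≤ (t.2.2 : ℝ) ^ x} := by
  set A := {t : ℕ × ℕ × ℕ | IsABCTriple t.1 t.2.1 t.2.2 ∧ t.2.2 ≤ N ∧
    ((rad t.1 t.2.1 t.2.2 : ℕ) : ℝ) ≤ (t.2.2 : ℝ) ^ (x - η)} with hA
  set B := {t : ℕ × ℕ × ℕ | IsABCTriple t.1 t.2.1 t.2.2 ∧ t.2.2 ≤ N ∧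
    (t.2.2 : ℝ) ^ (x - η) < ((rad t.1 t.2.1 t.2.2 : ℕ) : ℝ) ∧
    ((rad t.1 t.2.1 t.2.2 : ℕ) : ℝ) ≤ (t.2.2 : ℝ) ^ x} with hB
  have hsub : {t : ℕ × ℕ × ℕ | IsABCTriple t.1 t.2.1 t.2.2 ∧ t.2.2 ≤ N ∧
      ((rad t.1 t.2.1 t.2.2 : ℕ) : ℝ) ≤ (t.2.2 : ℝ) ^ x} ⊆ A ∪ B := by
    rintro t ⟨ht, hN, hle⟩
    rcases le_or_gt (((rad t.1 t.2.1 t.2.2 : ℕ) : ℝ)) ((t.2.2 : ℝ) ^ (x - η)) with h | h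
    · exact Or.inl ⟨ht, hN, h⟩
    · exact Or.inr ⟨ht, hN, h, hle⟩
  have hfin : (A ∪ B).Finite :=
    (MazurKaneLaw.finite_of_isABCTriple N fun _ ht => ⟨ht.1, ht.2.1⟩).union
      (MazurKaneLaw.finite_of_isABCTriple N fun _ ht => ⟨ht.1, ht.2.1⟩)
  have h1 := Set.ncard_le_ncard hsub hfin
  have h2 := Set.ncard_union_le A B
  exact_mod_cast h1.trans h2

/-- Shrinking the window shrinks the slice (counting form). [folklore] -/
theorem MazurKaneLaw.ncard_slice_mono (N : ℕ) (x : ℝ) {η η' : ℝ} (h : η ≤ η') :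
    (Set.ncard {t : ℕ × ℕ × ℕ | IsABCTriple t.1 t.2.1 t.2.2 ∧ t.2.2 ≤ N ∧
        (t.2.2 : ℝ) ^ (x - η) < ((rad t.1 t.2.1 t.2.2 : ℕ) : ℝ) ∧
        ((rad t.1 t.2.1 t.2.2 : ℕ) : ℝ) ≤ (t.2.2 : ℝ) ^ x} : ℝ) ≤
      Set.ncard {t : ℕ × ℕ × ℕ | IsABCTriple t.1 t.2.1 t.2.2 ∧ t.2.2 ≤ N ∧
        (t.2.2 : ℝ) ^ (x - η') < ((rad t.1 t.2.1 t.2.2 : ℕ) : ℝ) ∧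
        ((rad t.1 t.2.1 t.2.2 : ℕ) : ℝ) ≤ (t.2.2 : ℝ) ^ x} := by
  have hfin : {t : ℕ × ℕ × ℕ | IsABCTriple t.1 t.2.1 t.2.2 ∧ t.2.2 ≤ N ∧
      (t.2.2 : ℝ) ^ (x - η') < ((rad t.1 t.2.1 t.2.2 : ℕ) : ℝ) ∧
      ((rad t.1 t.2.1 t.2.2 : ℕ) : ℝ) ≤ (t.2.2 : ℝ) ^ x}.Finite :=
    MazurKaneLaw.finite_of_isABCTriple N fun _ ht => ⟨ht.1, ht.2.1⟩
  refine Nat.cast_le.mpr (Set.ncard_le_ncard (fun t ht => ?_) hfin)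
  obtain ⟨ht, hN, hlt, hle⟩ := ht
  exact ⟨ht, hN, lt_of_le_of_lt (Real.rpow_le_rpow_of_exponent_le (MazurKaneLaw.one_le_of_isABCTriple ht)
    (by linarith)) hlt, hle⟩

/-- At the floor `x = 1` the cumulative set consists of abc hits `rad(abc) ≤ c` (counting form). [folklore] -/
theorem MazurKaneLaw.ncard_cumulative_one_le_hits (N : ℕ) :
    (Set.ncard {t : ℕ × ℕ × ℕ | IsABCTriple t.1 t.2.1 t.2.2 ∧ t.2.2 ≤ N ∧
        ((rad t.1 t.2.1 t.2.2 : ℕ) : ℝ) ≤ (t.2.2 : ℝ) ^ (1 : ℝ)} : ℝ) ≤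
      Set.ncard {t : ℕ × ℕ × ℕ | IsABCTriple t.1 t.2.1 t.2.2 ∧ t.2.2 ≤ N ∧
        rad t.1 t.2.1 t.2.2 ≤ t.2.2} := by
  have hfin : {t : ℕ × ℕ × ℕ | IsABCTriple t.1 t.2.1 t.2.2 ∧ t.2.2 ≤ N ∧
      rad t.1 t.2.1 t.2.2 ≤ t.2.2}.Finite :=
    MazurKaneLaw.finite_of_isABCTriple N fun _ ht => ⟨ht.1, ht.2.1⟩
  refine Nat.cast_le.mpr (Set.ncard_le_ncard (fun t ht => ?_) hfin)
  obtain ⟨ht, hN, hle⟩ := ht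
  refine ⟨ht, hN, ?_⟩
  rw [Real.rpow_one] at hle
  exact_mod_cast hle

/-! ## The crux from the three ranges -/

/-- **The Mazur–Kane law at every `1 < s < 2` from the three radical ranges** (slice law on `[5/3,2)`, slice
law on `(1,5/3)`, hit bound): floor at `x₀ = 1` (hits), slices of the common width `η = min(η_high, η_low)` up to
`s`, all partial bounds weakened to the exponent `s - 1 + ε` (`N ≥ 1`). The conclusion is the BODY of the route
decl `MazurKaneLaw`; see `SliceAssembly` for the named form. [folklore] -/
theorem MazurKaneLaw.lawAt_of_slices
    (hHigh : ∀ ε : ℝ, 0 < ε → ∃ η : ℝ, 0 < η ∧ ∀ s : ℝ, 5 / 3 ≤ s → s < 2 → ∃ C : ℝ, ∀ N : ℕ, 2 ≤ N →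
      (Set.ncard {t : ℕ × ℕ × ℕ | IsABCTriple t.1 t.2.1 t.2.2 ∧ t.2.2 ≤ N ∧
          (t.2.2 : ℝ) ^ (s - η) < ((rad t.1 t.2.1 t.2.2 : ℕ) : ℝ) ∧
          ((rad t.1 t.2.1 t.2.2 : ℕ) : ℝ) ≤ (t.2.2 : ℝ) ^ s} : ℝ) ≤ C * (N : ℝ) ^ (s - 1 + ε))
    (hLow : ∀ ε : ℝ, 0 < ε → ∃ η : ℝ, 0 < η ∧ ∀ s : ℝ, 1 < s → s < 5 / 3 → ∃ C : ℝ, ∀ N : ℕ, 2 ≤ N →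
      (Set.ncard {t : ℕ × ℕ × ℕ | IsABCTriple t.1 t.2.1 t.2.2 ∧ t.2.2 ≤ N ∧
          (t.2.2 : ℝ) ^ (s - η) < ((rad t.1 t.2.1 t.2.2 : ℕ) : ℝ) ∧
          ((rad t.1 t.2.1 t.2.2 : ℕ) : ℝ) ≤ (t.2.2 : ℝ) ^ s} : ℝ) ≤ C * (N : ℝ) ^ (s - 1 + ε))
    (hHit : ∀ ε : ℝ, 0 < ε → ∃ C : ℝ, ∀ N : ℕ, 2 ≤ N →
      (Set.ncard {t : ℕ × ℕ × ℕ | IsABCTriple t.1 t.2.1 t.2.2 ∧ t.2.2 ≤ N ∧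
          rad t.1 t.2.1 t.2.2 ≤ t.2.2} : ℝ) ≤ C * (N : ℝ) ^ ε) :
    ∀ s : ℝ, 1 < s → s < 2 → ∀ ε : ℝ, 0 < ε → ∃ C : ℝ, ∀ N : ℕ, 2 ≤ N →
      (Set.ncard {t : ℕ × ℕ × ℕ | IsABCTriple t.1 t.2.1 t.2.2 ∧ t.2.2 ≤ N ∧
        ((rad t.1 t.2.1 t.2.2 : ℕ) : ℝ) ≤ (t.2.2 : ℝ) ^ s} : ℝ) ≤ C * (N : ℝ) ^ (s - 1 + ε) := by
  intro s hs1 hs2 ε hε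
  obtain ⟨ηH, hηH, hH⟩ := hHigh ε hε
  obtain ⟨ηL, hηL, hL⟩ := hLow ε hε
  obtain ⟨Ch, hCh⟩ := hHit ε hε
  obtain ⟨η, hη0, hηH', hηL'⟩ : ∃ η : ℝ, 0 < η ∧ η ≤ ηH ∧ η ≤ ηL :=
    ⟨min ηH ηL, lt_min hηH hηL, min_le_left _ _, min_le_right _ _⟩
  -- slice constants at every level `x ∈ (1, 2)`, for the common window `η`
  have key : ∀ x : ℝ, 1 < x → x < 2 → ∃ C : ℝ, ∀ N : ℕ, 2 ≤ N →
      (Set.ncard {t : ℕ × ℕ × ℕ | IsABCTriple t.1 t.2.1 t.2.2 ∧ t.2.2 ≤ N ∧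
          (t.2.2 : ℝ) ^ (x - η) < ((rad t.1 t.2.1 t.2.2 : ℕ) : ℝ) ∧
          ((rad t.1 t.2.1 t.2.2 : ℕ) : ℝ) ≤ (t.2.2 : ℝ) ^ x} : ℝ) ≤ C * (N : ℝ) ^ (x - 1 + ε) := by
    intro x hx1 hx2
    rcases le_or_gt (5 / 3 : ℝ) x with h53 | h53
    · obtain ⟨C, hC⟩ := hH x h53 hx2
      exact ⟨C, fun N hN => (MazurKaneLaw.ncard_slice_mono N x hηH').trans (hC N hN)⟩
    · obtain ⟨C, hC⟩ := hL x hx1 h53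
      exact ⟨C, fun N hN => (MazurKaneLaw.ncard_slice_mono N x hηL').trans (hC N hN)⟩
  choose! Cf hCf using key
  obtain ⟨J, hJ⟩ : ∃ J : ℕ, s - J * η ≤ 1 := MazurKaneLaw.exists_steps hη0
  refine ⟨max Ch 0 + ∑ j ∈ Finset.range J, max (Cf (s - j * η)) 0, fun N hN => ?_⟩
  have hN1 : (1 : ℝ) ≤ N := by exact_mod_cast (show 1 ≤ N by omega)
  have hN0 : (0 : ℝ) ≤ N := by linarith
  have hpow : ∀ {p q : ℝ}, p ≤ q → (N : ℝ) ^ p ≤ (N : ℝ) ^ q := fun h =>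
    Real.rpow_le_rpow_of_exponent_le hN1 h
  -- the abstract assembly, instantiated with the cumulative count and the slices of width `η`
  have hmain := MazurKaneLaw.assemble (x₀ := 1) (xmax := s) (P := (N : ℝ) ^ (s - 1 + ε))
    (C₀ := max Ch 0)
    (m := fun x => (Set.ncard {t : ℕ × ℕ × ℕ | IsABCTriple t.1 t.2.1 t.2.2 ∧ t.2.2 ≤ N ∧
        ((rad t.1 t.2.1 t.2.2 : ℕ) : ℝ) ≤ (t.2.2 : ℝ) ^ x} : ℝ))
    (sl := fun x => (Set.ncard {t : ℕ × ℕ × ℕ | IsABCTriple t.1 t.2.1 t.2.2 ∧ t.2.2 ≤ N ∧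
        (t.2.2 : ℝ) ^ (x - η) < ((rad t.1 t.2.1 t.2.2 : ℕ) : ℝ) ∧
        ((rad t.1 t.2.1 t.2.2 : ℕ) : ℝ) ≤ (t.2.2 : ℝ) ^ x} : ℝ))
    hη0 (Real.rpow_nonneg hN0 _) (fun x y hxy => MazurKaneLaw.ncard_cumulative_mono N hxy)
    (fun x => MazurKaneLaw.ncard_cumulative_peel N x η) ?_ (fun x => max (Cf x) 0)
    (fun x => le_max_right _ _) ?_ J s le_rfl hJ
  · exact hmain
  · -- the floor: hits
    have h2 : (Set.ncard {t : ℕ × ℕ × ℕ | IsABCTriple t.1 t.2.1 t.2.2 ∧ t.2.2 ≤ N ∧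
        rad t.1 t.2.1 t.2.2 ≤ t.2.2} : ℝ) ≤ Ch * (N : ℝ) ^ ε := hCh N hN
    calc (Set.ncard {t : ℕ × ℕ × ℕ | IsABCTriple t.1 t.2.1 t.2.2 ∧ t.2.2 ≤ N ∧
            ((rad t.1 t.2.1 t.2.2 : ℕ) : ℝ) ≤ (t.2.2 : ℝ) ^ (1 : ℝ)} : ℝ)
          ≤ Ch * (N : ℝ) ^ ε := (MazurKaneLaw.ncard_cumulative_one_le_hits N).trans h2
      _ ≤ max Ch 0 * (N : ℝ) ^ ε := mul_le_mul_of_nonneg_right (le_max_left _ _) (Real.rpow_nonneg hN0 _)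
      _ ≤ max Ch 0 * (N : ℝ) ^ (s - 1 + ε) :=
          mul_le_mul_of_nonneg_left (hpow (by linarith)) (le_max_right _ _)
  · -- the slices
    intro x hx1 hxs
    have h := (hCf x hx1 (by linarith)) N hN
    calc (Set.ncard {t : ℕ × ℕ × ℕ | IsABCTriple t.1 t.2.1 t.2.2 ∧ t.2.2 ≤ N ∧
            (t.2.2 : ℝ) ^ (x - η) < ((rad t.1 t.2.1 t.2.2 : ℕ) : ℝ) ∧
            ((rad t.1 t.2.1 t.2.2 : ℕ) : ℝ) ≤ (t.2.2 : ℝ) ^ x} : ℝ)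
          ≤ Cf x * (N : ℝ) ^ (x - 1 + ε) := h
      _ ≤ max (Cf x) 0 * (N : ℝ) ^ (x - 1 + ε) :=
          mul_le_mul_of_nonneg_right (le_max_left _ _) (Real.rpow_nonneg hN0 _)
      _ ≤ max (Cf x) 0 * (N : ℝ) ^ (s - 1 + ε) :=
          mul_le_mul_of_nonneg_left (hpow (by linarith)) (le_max_right _ _)

/-- **Glue for the range split of the crux** `TwistAmplification.MazurKaneLaw` (stmt-ABC-2757), registered name
`SliceAssembly`: the slice law on `[5/3, 2)`, the slice law on `(1, 5/3)` and the hit bound — verbatim the statements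
`SliceLawHigh`, `SliceLawLow`, `HitBound` of the line `peyre-level-torsor-v22` — imply the crux by name. [folklore] -/
theorem SliceAssembly : (∀ ε : ℝ, 0 < ε → ∃ η : ℝ, 0 < η ∧ ∀ s : ℝ, 5 / 3 ≤ s → s < 2 → ∃ C : ℝ, ∀ N : ℕ, 2 ≤ N → (Set.ncard {t : ℕ × ℕ × ℕ | Literature.NumberTheory.DiophantineGeometry.IsABCTriple t.1 t.2.1 t.2.2 ∧ t.2.2 ≤ N ∧ (t.2.2 : ℝ) ^ (s - η) < ((Literature.NumberTheory.DiophantineGeometry.rad t.1 t.2.1 t.2.2 : ℕ) : ℝ) ∧ ((Literature.NumberTheory.DiophantineGeometry.rad t.1 t.2.1 t.2.2 : ℕ) : ℝ) ≤ (t.2.2 : ℝ) ^ s} : ℝ) ≤ C * (N : ℝ) ^ (s - 1 + ε)) → (∀ ε : ℝ, 0 < ε → ∃ η : ℝ, 0 < η ∧ ∀ s : ℝ, 1 < s → s < 5 / 3 → ∃ C : ℝ, ∀ N : ℕ, 2 ≤ N → (Set.ncard {t : ℕ × ℕ × ℕ | Literature.NumberTheory.DiophantineGeometry.IsABCTriple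 t.1 t.2.1 t.2.2 ∧ t.2.2 ≤ N ∧ (t.2.2 : ℝ) ^ (s - η) < ((Literature.NumberTheory.DiophantineGeometry.rad t.1 t.2.1 t.2.2 : ℕ) : ℝ) ∧ ((Literature.NumberTheory.DiophantineGeometry.rad t.1 t.2.1 t.2.2 : ℕ) : ℝ) ≤ (t.2.2 : ℝ) ^ s} : ℝ) ≤ C * (N : ℝ) ^ (s - 1 + ε)) → (∀ ε : ℝ, 0 < ε → ∃ C : ℝ, ∀ N : ℕ, 2 ≤ N → (Set.ncard {t : ℕ × ℕ × ℕ | Literature.NumberTheory.DiophantineGeometry.IsABCTriple t.1 t.2.1 t.2.2 ∧ t.2.2 ≤ N ∧ Literature.NumberTheory.DiophantineGeometry.rad t.1 t.2.1 t.2.2 ≤ t.2.2} : ℝ) ≤ C * (N : ℝ) ^ ε) → Summit.ABC.ABC.Theses.TwistAmplification.MazurKaneLaw :=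
  fun hHigh hLow hHit => MazurKaneLaw.lawAt_of_slices hHigh hLow hHit

end Summit.ABC.ABC.Theorems
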